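import Summits.QuantumFields.YangMills.Theorems.ColdStartUniversalityLatticeLangevinLawUniqueStart
import Summits.QuantumFields.YangMills.Theorems.ColdStartUniversalityLatticeLangevinNoiseRotationFiltration
import HarnessLib

/-!
# Route `ColdStartUniversality` (cruxes 27363 / 24810 / aside 24809): THE SZZ LATTICE LANGEVIN DYNAMICS COMMUTES WITH THE
# LATTICE TRANSLATIONS — pathwise, in law, and on the Markov semigroup; the cold-start law is translation invariant

Helper file (seat `ym-line-csu-p1`, g14; `--supports stmt-QuantumFields-27363`).  Companion of the gauge covariance
(g10/g11, `…LatticeLangevinGaugeCovariance*`) and the centre covariance (g14, `…LatticeLangevinCentreCovariance*`) of the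
`SU(2)` Shen–Zhu–Zhu dynamics on `(ℤ/L)³`: the third exact symmetry of the finite periodic box, the translation group
`(ℤ/L)³` acting on configurations by `(U ∘ τ_a)(x, i) = U(x + a, i)`.

* §1 (algebra, any `r`, `d`): the rooted plaquette loops, the SZZ drift and the noise coefficients of `Q ∘ τ_a` at `e` are
  those of `Q` at `τ_a e` (`rootedLoop_translate`, `drift_translate`, `noise_translate`);
* §2 the relabelled driver `W'^{e,n} = W^{τ_a e, n}` is a flat Brownian noise with the SAME raw natural filtration
  (`isFlatBrownian_translate`, `natFiltration_translate_eq` — a permutation matrix is orthogonal,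
  `NoiseRotation.isFlatBrownian_orthogonal`);
* §3 ★ `isSolution_translate` — `U` solves the system driven by `W` w.r.t. `𝓕` ⇒ `U ∘ τ_a` solves it driven by `W'`
  w.r.t. the same `𝓕` (Itô integrals relabelled);
* §4 ★ `map_translate_eq` (law(V' from u∘τ_a at t) = (∘τ_a)_* law(V from u at t), ANY two solutions),
  ★ `markovTransition_translate` (`P_t f (x ∘ τ_a) = P_t (f ∘ (· ∘ τ_a)) x`), ★ `map_translate_coldStart`
  (the cold start `1` is translation invariant, hence so is the law of EVERY cold-start solution at every time),
  `integral_translate_coldStart` (`E f(U_t ∘ τ_a) = E f(U_t)`).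

THEOREMS ONLY, [folklore] (equivariance of an SDE under a relabelling symmetry of its coefficients and an independent
relabelling of i.i.d. drivers).  RECORD-rung R3 plumbing: no crux, rung or summit statement is proved here and the
Yang–Mills mass gap is NOT proved.
-/

set_option autoImplicit false

noncomputable section

namespace Summit.QuantumFields.YangMills.Theorems.ColdStartUniversality.TranslationCovariance

open MeasureTheory ProbabilityTheory Filter Matrix
open scoped NNReal ENNReal BigOperators
open Literature.Probability.Process Literature.MathematicalPhysics.QuantumFieldTheory
open Literature.MathematicalPhysics.QuantumLattice (fundamentalRep fundamentalLatticeRep)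

/-! ## §1 Algebra: the SDE data are translation covariant -/

section Algebra

variable {G : Type*} [Group G] [TopologicalSpace G] (r : LatticeRep G) {d L N : ℕ}

/-- `(x + a) + eᵢ = (x + eᵢ) + a`. [folklore] -/
theorem shift_add_right (x a : Literature.MathematicalPhysics.QuantumFieldTheory.Site d L) (i : Fin d) :
    (x + a).shift i = x.shift i + a := by
  simp only [Literature.MathematicalPhysics.QuantumFieldTheory.Site.shift]
  exact add_right_comm _ _ _

/-- `(x + a) − eⱼ = (x − eⱼ) + a`. [folklore] -/
theorem add_sub_single (x a : Literature.MathematicalPhysics.QuantumFieldTheory.Site d L) (j : Fin d) :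
    (x + a) - Pi.single j (1 : ZMod L) = (x - Pi.single j (1 : ZMod L)) + a :=
  add_sub_right_comm _ _ _

/-- **The rooted plaquette loops are translation covariant**: the loops of `Q ∘ τ_a` rooted at `e = (x, i)` are the loops
of `Q` rooted at `τ_a e = (x + a, i)`. [cite: ShenZhuZhu2022, §3 (before Lemma 3.1)] -/
theorem rootedLoop_translate (Q : MatrixConfig d L N) (a : Literature.MathematicalPhysics.QuantumFieldTheory.Site d L)
    (e : Edge d L) (j : Fin d) (b : Bool) :
    rootedLoop (fun e' : Edge d L => Q (e'.1 + a, e'.2)) e j b = rootedLoop Q (e.1 + a, e.2) j b := by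
  obtain ⟨x, i⟩ := e
  cases b with
  | false => simp only [rootedLoop, shift_add_right]
  | true => simp only [rootedLoop, shift_add_right, add_sub_single]

/-- **The Lie drift is translation covariant.** [cite: ShenZhuZhu2022, §3 Lemma 3.1] -/
theorem driftLie_translate (β : ℝ) (Q : MatrixConfig d L r.N) (a : Literature.MathematicalPhysics.QuantumFieldTheory.Site d L)
    (e : Edge d L) :
    r.driftLie β (fun e' : Edge d L => Q (e'.1 + a, e'.2)) e = r.driftLie β Q (e.1 + a, e.2) := by
  unfold LatticeRep.driftLie
  refine congrArg (fun M : Matrix (Fin r.N) (Fin r.N) ℂ => β • M) ?_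
  refine Finset.sum_congr rfl fun j _ => Finset.sum_congr rfl fun b _ => ?_
  rw [rootedLoop_translate Q a e j b]

/-- ★ **The SZZ drift is translation covariant**: `b_e(Q ∘ τ_a) = b_{τ_a e}(Q)`. [cite: ShenZhuZhu2022, §3 Lemma 3.1] -/
theorem drift_translate (β : ℝ) (Q : MatrixConfig d L r.N) (a : Literature.MathematicalPhysics.QuantumFieldTheory.Site d L)
    (e : Edge d L) :
    (latticeLangevinDynamics r β).drift (fun e' : Edge d L => Q (e'.1 + a, e'.2)) e =
      (latticeLangevinDynamics r β).drift Q (e.1 + a, e.2) := by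
  simp only [latticeLangevinDynamics_drift]
  rw [driftLie_translate]

/-- ★ **The SZZ noise coefficients are translation covariant**: `σ_{e,n}(Q ∘ τ_a) = σ_{τ_a e, n}(Q)`.
[cite: ShenZhuZhu2022, §3 (the SDE system after Lemma 3.1)] -/
theorem noise_translate (β : ℝ) (Q : MatrixConfig d L r.N) (a : Literature.MathematicalPhysics.QuantumFieldTheory.Site d L)
    (e : Edge d L) (n : NoiseIdx r.N) :
    (latticeLangevinDynamics r β).noise (fun e' : Edge d L => Q (e'.1 + a, e'.2)) e n =
      (latticeLangevinDynamics r β).noise Q (e.1 + a, e.2) n := by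
  simp only [latticeLangevinDynamics_noise]

end Algebra

/-! ## §2 The relabelled driver is a flat Brownian noise with the same natural filtration -/

section Noise

variable {d L : ℕ} [NeZero L] {κ : Type*} [Fintype κ] [DecidableEq κ] {Ω : Type*} {mΩ : MeasurableSpace Ω}
  {P : Measure Ω}

/-- The permutation matrix of the relabelling `(e, n) ↦ (τ_a e, n)` is orthogonal and acts on noise paths by the
relabelling. [folklore] -/
theorem translate_permMatrix (a : Literature.MathematicalPhysics.QuantumFieldTheory.Site d L) :
    ((Matrix.of fun i j : Edge d L × κ => if j = ((i.1.1 + a, i.1.2), i.2) then (1 : ℝ) else 0).transpose *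
        (Matrix.of fun i j : Edge d L × κ => if j = ((i.1.1 + a, i.1.2), i.2) then (1 : ℝ) else 0) = 1) ∧
    ∀ (W : ℝ≥0 → Ω → (Edge d L × κ → ℝ)),
      (fun t ω (i : Edge d L × κ) => ∑ j,
        (Matrix.of fun i j : Edge d L × κ => if j = ((i.1.1 + a, i.1.2), i.2) then (1 : ℝ) else 0) i j * W t ω j) =
      fun t ω p => W t ω ((p.1.1 + a, p.1.2), p.2) := by
  classical
  -- the relabelling as an equivalence
  let σ : Edge d L × κ ≃ Edge d L × κ :=
    { toFun := fun p => ((p.1.1 + a, p.1.2), p.2)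
      invFun := fun p => ((p.1.1 - a, p.1.2), p.2)
      left_inv := fun p => by simp
      right_inv := fun p => by simp }
  have hσ : ∀ p : Edge d L × κ, σ p = ((p.1.1 + a, p.1.2), p.2) := fun p => rfl
  refine ⟨?_, fun W => ?_⟩
  · ext q q'
    simp only [Matrix.mul_apply, Matrix.transpose_apply, Matrix.of_apply]
    have hrew : ∀ p : Edge d L × κ, ((if q = ((p.1.1 + a, p.1.2), p.2) then (1 : ℝ) else 0) *
        (if q' = ((p.1.1 + a, p.1.2), p.2) then (1 : ℝ) else 0)) =
        if p = σ.symm q then (if q = q' then (1 : ℝ) else 0) else 0 := by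
      intro p
      by_cases hp : p = σ.symm q
      · have hq : q = σ p := by rw [hp, Equiv.apply_symm_apply]
        rw [if_pos hp, ← hσ p, if_pos hq, one_mul, ← hq]
        by_cases hqq : q = q'
        · rw [if_pos hqq, if_pos hqq.symm]
        · rw [if_neg hqq, if_neg (Ne.symm hqq)]
      · have hq : q ≠ ((p.1.1 + a, p.1.2), p.2) := by
          intro h
          apply hp
          rw [← hσ p] at h
          rw [h, Equiv.symm_apply_apply]
        rw [if_neg hq, zero_mul, if_neg hp]
    simp_rw [hrew]
    rw [Finset.sum_ite_eq' Finset.univ (σ.symm q), if_pos (Finset.mem_univ _), Matrix.one_apply]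
  · funext t ω i
    simp only [Matrix.of_apply]
    have hrew : ∀ j : Edge d L × κ, (if j = ((i.1.1 + a, i.1.2), i.2) then (1 : ℝ) else 0) * W t ω j =
        if j = ((i.1.1 + a, i.1.2), i.2) then W t ω j else 0 := fun j => by
      split_ifs <;> simp
    simp_rw [hrew]
    rw [Finset.sum_ite_eq' Finset.univ, if_pos (Finset.mem_univ _)]

/-- ★ **The relabelled driver `W'^{e,n} = W^{τ_a e, n}` is a flat Brownian noise.** [folklore] -/
theorem isFlatBrownian_translate {W : ℝ≥0 → Ω → (Edge d L × κ → ℝ)} (hW : IsFlatBrownian W P)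
    (a : Literature.MathematicalPhysics.QuantumFieldTheory.Site d L) :
    IsFlatBrownian (fun t ω (p : Edge d L × κ) => W t ω ((p.1.1 + a, p.1.2), p.2)) P := by
  classical
  obtain ⟨hR, hfun⟩ := translate_permMatrix (Ω := Ω) (κ := κ) a
  rw [← hfun W]
  exact NoiseRotation.isFlatBrownian_orthogonal hW _ hR

/-- **… with the SAME raw natural filtration as `W`.** [folklore] -/
theorem natFiltration_translate_eq {W : ℝ≥0 → Ω → (Edge d L × κ → ℝ)} (hW : IsFlatBrownian W P)
    (a : Literature.MathematicalPhysics.QuantumFieldTheory.Site d L) :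
    (isFlatBrownian_translate hW a).natFiltration = hW.natFiltration := by
  classical
  obtain ⟨hR, hfun⟩ := translate_permMatrix (Ω := Ω) (κ := κ) a
  have key : ∀ (W₁ W₂ : ℝ≥0 → Ω → (Edge d L × κ → ℝ)) (h : W₁ = W₂) (h₁ : IsFlatBrownian W₁ P)
      (h₂ : IsFlatBrownian W₂ P), h₁.natFiltration = h₂.natFiltration := by
    intro W₁ W₂ h h₁ h₂
    subst h
    rfl
  rw [key _ _ (hfun W).symm (isFlatBrownian_translate hW a) (NoiseRotation.isFlatBrownian_orthogonal hW _ hR)]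
  exact NoiseRotation.natFiltration_orthogonal_eq hW _ hR

end Noise

/-! ## §3 The pathwise transfer -/

section Transfer

variable {L : ℕ} [NeZero L] {Ω : Type*} {mΩ : MeasurableSpace Ω} {P : Measure Ω} {𝓕 : Filtration ℝ≥0 mΩ}
  {W : ℝ≥0 → Ω → (Edge 3 L × NoiseIdx 2 → ℝ)}

omit [NeZero L] in
/-- `V ↦ V ∘ τ_a` is measurable for the product σ-algebras (pure relabelling of coordinates). [folklore] -/
theorem measurable_compTranslate {d : ℕ} {G : Type*} [MeasurableSpace G]
    (a : Literature.MathematicalPhysics.QuantumFieldTheory.Site d L) :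
    Measurable fun V : GaugeConfig d L G => fun e : Edge d L => V (e.1 + a, e.2) :=
  measurable_pi_lambda _ fun e => measurable_pi_apply (e.1 + a, e.2)

omit [NeZero L] in
/-- `V ↦ V ∘ τ_a` is continuous. [folklore] -/
theorem continuous_compTranslate {d : ℕ} {G : Type*} [TopologicalSpace G]
    (a : Literature.MathematicalPhysics.QuantumFieldTheory.Site d L) :
    Continuous fun V : GaugeConfig d L G => fun e : Edge d L => V (e.1 + a, e.2) :=
  continuous_pi fun e => continuous_apply (e.1 + a, e.2)

omit [NeZero L] in
/-- ★★ **The SZZ dynamics commutes with lattice translations (pathwise).**  If `U` solves the `SU(2)` lattice Langevin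
system at coupling `β'` driven by `W` w.r.t. a filtration `𝓕`, then the translated process `t ↦ U_t ∘ τ_a`,
`(U_t ∘ τ_a)(x, i) = U_t(x + a, i)`, solves the SAME system driven by the relabelled noise `W'^{e,n} = W^{τ_a e, n}`, w.r.t.
the same `𝓕` (its Itô integrals are `J^{τ_a e, n}`). [folklore] -/
theorem isSolution_translate (β' : ℝ) (a : Literature.MathematicalPhysics.QuantumFieldTheory.Site 3 L)
    {U : ℝ≥0 → Ω → GaugeConfig 3 L (Matrix.specialUnitaryGroup (Fin 2) ℂ)}
    (hU : (latticeLangevinDynamics (fundamentalLatticeRep 2) β').IsSolution (fundamentalRep (Fin 2)) 𝓕 P W U) :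
    (latticeLangevinDynamics (fundamentalLatticeRep 2) β').IsSolution (fundamentalRep (Fin 2)) 𝓕 P
      (fun t ω (p : Edge 3 L × NoiseIdx 2) => W t ω ((p.1.1 + a, p.1.2), p.2))
      (fun t ω (e : Edge 3 L) => U t ω (e.1 + a, e.2)) := by
  set r : LatticeRep (Matrix.specialUnitaryGroup (Fin 2) ℂ) := fundamentalLatticeRep 2 with hr
  have hQ : ∀ V : GaugeConfig 3 L (Matrix.specialUnitaryGroup (Fin 2) ℂ),
      matrixConfig r.ρ (fun e : Edge 3 L => V (e.1 + a, e.2)) = fun e : Edge 3 L => matrixConfig r.ρ V (e.1 + a, e.2) :=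
    fun V => rfl
  obtain ⟨J, hJ, hae⟩ := hU.exists_ito
  have hJ' : ∀ (e : Edge 3 L) (n : NoiseIdx r.N) (i j : Fin r.N),
      IsItoIntegralC (fun t ω => (latticeLangevinDynamics r β').noise (matrixConfig r.ρ (U t ω)) e n i j)
        (fun t ω => W t ω (e, n)) (J e n i j) 𝓕 P := fun e n i j => hJ e n i j
  have hae' : ∀ᵐ ω ∂P, ∀ (t : ℝ≥0) (e : Edge 3 L) (i j : Fin r.N),
      r.ρ (U t ω e) i j = r.ρ (U 0 ω e) i j +
        (∫ s in (0 : ℝ)..t, (latticeLangevinDynamics r β').drift (matrixConfig r.ρ (U s.toNNReal ω)) e i j) +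
        ∑ n : NoiseIdx r.N, J e n i j t ω := hae
  refine ⟨fun t => (measurable_compTranslate a).comp (hU.adapted t), ?_, ?_⟩
  · filter_upwards [hU.continuous] with ω hω using (continuous_compTranslate a).comp hω
  · refine ⟨fun e n i j t ω => J (e.1 + a, e.2) n i j t ω, fun e n i j => ?_, ?_⟩
    · have goal : IsItoIntegralC (fun t ω => (latticeLangevinDynamics r β').noise
          (matrixConfig r.ρ (fun e' : Edge 3 L => U t ω (e'.1 + a, e'.2))) e n i j)
          (fun t ω => W t ω ((e.1 + a, e.2), n)) (J (e.1 + a, e.2) n i j) 𝓕 P := by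
        have eN : (fun t ω => (latticeLangevinDynamics r β').noise
            (matrixConfig r.ρ (fun e' : Edge 3 L => U t ω (e'.1 + a, e'.2))) e n i j) =
            fun t ω => (latticeLangevinDynamics r β').noise (matrixConfig r.ρ (U t ω)) (e.1 + a, e.2) n i j := by
          funext t ω
          rw [hQ (U t ω), noise_translate r β' _ a e n]
        rw [eN]
        exact hJ' (e.1 + a, e.2) n i j
      exact goal
    · filter_upwards [hae'] with ω hω
      have key : ∀ (t : ℝ≥0) (e : Edge 3 L) (i j : Fin r.N),
          r.ρ (U t ω (e.1 + a, e.2)) i j = r.ρ (U 0 ω (e.1 + a, e.2)) i j +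
            (∫ s in (0 : ℝ)..t, (latticeLangevinDynamics r β').drift
              (matrixConfig r.ρ (fun e' : Edge 3 L => U s.toNNReal ω (e'.1 + a, e'.2))) e i j) +
            ∑ n : NoiseIdx r.N, J (e.1 + a, e.2) n i j t ω := by
        intro t e i j
        have hint : (∫ s in (0 : ℝ)..t, (latticeLangevinDynamics r β').drift
            (matrixConfig r.ρ (fun e' : Edge 3 L => U s.toNNReal ω (e'.1 + a, e'.2))) e i j) =
            ∫ s in (0 : ℝ)..t, (latticeLangevinDynamics r β').drift (matrixConfig r.ρ (U s.toNNReal ω)) (e.1 + a, e.2) i j := by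
          refine intervalIntegral.integral_congr fun s _ => ?_
          show (latticeLangevinDynamics r β').drift
              (matrixConfig r.ρ (fun e' : Edge 3 L => U s.toNNReal ω (e'.1 + a, e'.2))) e i j = _
          rw [hQ (U s.toNNReal ω), drift_translate r β' _ a e]
        rw [hint]
        exact hω t (e.1 + a, e.2) i j
      intro t e i j
      exact key t e i j

end Transfer

/-! ## §4 Covariance in law; the Markov semigroup; the cold-start law is translation invariant -/

section Law

variable {L : ℕ} [NeZero L]

/-- ★★ **Translation covariance in law of the SZZ dynamics.**  For every start `u`, every lattice vector `a`, every
solution `V` from `u` and every solution `V'` from `u ∘ τ_a` (each on its own probability space in `Type` with its own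
flat driver, raw natural filtrations): `law(V'_t) = (∘τ_a)_* law(V_t)` for all `t`. [folklore] -/
theorem map_translate_eq (β' : ℝ) (a : Literature.MathematicalPhysics.QuantumFieldTheory.Site 3 L)
    (u : GaugeConfig 3 L (Matrix.specialUnitaryGroup (Fin 2) ℂ))
    {Ω : Type} {mΩ : MeasurableSpace Ω} {P : Measure Ω} [IsProbabilityMeasure P]
    {W : ℝ≥0 → Ω → (Edge 3 L × NoiseIdx 2 → ℝ)} (hW : IsFlatBrownian W P)
    {V : ℝ≥0 → Ω → GaugeConfig 3 L (Matrix.specialUnitaryGroup (Fin 2) ℂ)}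
    (hV0 : ∀ ω, V 0 ω = u)
    (hV : (latticeLangevinDynamics (fundamentalLatticeRep 2) β').IsSolution (fundamentalRep (Fin 2))
      hW.natFiltration P W V)
    {Ω' : Type} {mΩ' : MeasurableSpace Ω'} {P' : Measure Ω'} [IsProbabilityMeasure P']
    {W' : ℝ≥0 → Ω' → (Edge 3 L × NoiseIdx 2 → ℝ)} (hW' : IsFlatBrownian W' P')
    {V' : ℝ≥0 → Ω' → GaugeConfig 3 L (Matrix.specialUnitaryGroup (Fin 2) ℂ)}
    (hV'0 : ∀ ω, V' 0 ω = fun e : Edge 3 L => u (e.1 + a, e.2))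
    (hV' : (latticeLangevinDynamics (fundamentalLatticeRep 2) β').IsSolution (fundamentalRep (Fin 2))
      hW'.natFiltration P' W' V') (t : ℝ≥0) :
    Measure.map (V' t) P' = (Measure.map (V t) P).map (fun x : GaugeConfig 3 L (Matrix.specialUnitaryGroup (Fin 2) ℂ) =>
      fun e : Edge 3 L => x (e.1 + a, e.2)) := by
  have hsol := isSolution_translate β' a hV
  have hWa := isFlatBrownian_translate hW a
  have hF := natFiltration_translate_eq hW a
  have hsol' : (latticeLangevinDynamics (fundamentalLatticeRep 2) β').IsSolution (fundamentalRep (Fin 2))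
      hWa.natFiltration P (fun t ω (p : Edge 3 L × NoiseIdx 2) => W t ω ((p.1.1 + a, p.1.2), p.2))
      (fun t ω (e : Edge 3 L) => V t ω (e.1 + a, e.2)) := by
    rw [hF]
    exact hsol
  have h2 : Measure.map (V' t) P' = Measure.map (fun ω => fun e : Edge 3 L => V t ω (e.1 + a, e.2)) P :=
    lawUnique_of_start β' _ hW' hWa hV'0 hV' (fun ω => by simp only [hV0 ω]) hsol' t
  have hmV : Measurable (V t) := (hV.adapted t).mono (hW.natFiltration.le t) le_rfl
  rw [h2, Measure.map_map (measurable_compTranslate a) hmV]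
  rfl

/-- ★ **The Markov semigroup commutes with translations**: for every solution family `(U^x)_x` (one space, one flat
driver), every measurable `f`, every `t` and lattice vector `a`: `P_t f (x ∘ τ_a) = P_t (f ∘ (· ∘ τ_a)) x`. [folklore] -/
theorem markovTransition_translate (β' : ℝ) {Ω : Type} {mΩ : MeasurableSpace Ω} {P : Measure Ω} [IsProbabilityMeasure P]
    {W : ℝ≥0 → Ω → (Edge 3 L × NoiseIdx 2 → ℝ)} (hW : IsFlatBrownian W P)
    {U : GaugeConfig 3 L (Matrix.specialUnitaryGroup (Fin 2) ℂ) → ℝ≥0 → Ω →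
      GaugeConfig 3 L (Matrix.specialUnitaryGroup (Fin 2) ℂ)}
    (hU : ∀ x, (∀ ω, U x 0 ω = x) ∧
      (latticeLangevinDynamics (fundamentalLatticeRep 2) β').IsSolution (fundamentalRep (Fin 2))
        hW.natFiltration P W (U x))
    (a : Literature.MathematicalPhysics.QuantumFieldTheory.Site 3 L)
    {f : GaugeConfig 3 L (Matrix.specialUnitaryGroup (Fin 2) ℂ) → ℝ} (hf : Measurable f) (t : ℝ≥0)
    (x : GaugeConfig 3 L (Matrix.specialUnitaryGroup (Fin 2) ℂ)) :
    markovTransition U P t f (fun e : Edge 3 L => x (e.1 + a, e.2)) =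
      markovTransition U P t (f ∘ fun y : GaugeConfig 3 L (Matrix.specialUnitaryGroup (Fin 2) ℂ) =>
        fun e : Edge 3 L => y (e.1 + a, e.2)) x := by
  have hlaw := map_translate_eq β' a x hW (hU x).1 (hU x).2 hW (hU (fun e : Edge 3 L => x (e.1 + a, e.2))).1
    (hU (fun e : Edge 3 L => x (e.1 + a, e.2))).2 t
  have hm : ∀ y, Measurable (U y t) := fun y => ((hU y).2.adapted t).mono (hW.natFiltration.le t) le_rfl
  unfold markovTransition
  calc ∫ ω, f (U (fun e : Edge 3 L => x (e.1 + a, e.2)) t ω) ∂P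
      = ∫ v, f v ∂(Measure.map (U (fun e : Edge 3 L => x (e.1 + a, e.2)) t) P) :=
        (integral_map (hm _).aemeasurable hf.aestronglyMeasurable).symm
    _ = ∫ v, f v ∂((Measure.map (U x t) P).map (fun y : GaugeConfig 3 L (Matrix.specialUnitaryGroup (Fin 2) ℂ) =>
          fun e : Edge 3 L => y (e.1 + a, e.2))) := by rw [hlaw]
    _ = ∫ v, (f ∘ fun y : GaugeConfig 3 L (Matrix.specialUnitaryGroup (Fin 2) ℂ) => fun e : Edge 3 L => y (e.1 + a, e.2)) v
          ∂(Measure.map (U x t) P) :=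
        integral_map (measurable_compTranslate a).aemeasurable hf.aestronglyMeasurable
    _ = ∫ ω, (f ∘ fun y : GaugeConfig 3 L (Matrix.specialUnitaryGroup (Fin 2) ℂ) => fun e : Edge 3 L => y (e.1 + a, e.2))
          (U x t ω) ∂P :=
        integral_map (hm _).aemeasurable (hf.comp (measurable_compTranslate a)).aestronglyMeasurable

/-- ★★ **THE COLD-START LAW IS TRANSLATION INVARIANT AT EVERY TIME**: for every cold-start solution `U` (start `1`, any
probability space, any flat driver) and every `t`, `a`: `(∘τ_a)_* law(U_t) = law(U_t)` — the cold start is translation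
invariant and the law from a given start is unique. [folklore] -/
theorem map_translate_coldStart (β' : ℝ) (a : Literature.MathematicalPhysics.QuantumFieldTheory.Site 3 L)
    {Ω : Type} {mΩ : MeasurableSpace Ω} {P : Measure Ω} [IsProbabilityMeasure P]
    {W : ℝ≥0 → Ω → (Edge 3 L × NoiseIdx 2 → ℝ)} (hW : IsFlatBrownian W P)
    {U : ℝ≥0 → Ω → GaugeConfig 3 L (Matrix.specialUnitaryGroup (Fin 2) ℂ)}
    (hU0 : ∀ ω, U 0 ω = fun _ => 1)
    (hU : (latticeLangevinDynamics (fundamentalLatticeRep 2) β').IsSolution (fundamentalRep (Fin 2))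
      hW.natFiltration P W U) (t : ℝ≥0) :
    (Measure.map (U t) P).map (fun x : GaugeConfig 3 L (Matrix.specialUnitaryGroup (Fin 2) ℂ) =>
      fun e : Edge 3 L => x (e.1 + a, e.2)) = Measure.map (U t) P :=
  (map_translate_eq β' a (fun _ => 1) hW hU0 hU hW (V' := U) (fun ω => by rw [hU0 ω]) hU t).symm

/-- ★ **Cold-start expectations are translation invariant**: `E f(U_t ∘ τ_a) = E f(U_t)` for every measurable `f`, every
cold-start solution, every `t` and `a`. [folklore] -/
theorem integral_translate_coldStart (β' : ℝ) (a : Literature.MathematicalPhysics.QuantumFieldTheory.Site 3 L)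
    {Ω : Type} {mΩ : MeasurableSpace Ω} {P : Measure Ω} [IsProbabilityMeasure P]
    {W : ℝ≥0 → Ω → (Edge 3 L × NoiseIdx 2 → ℝ)} (hW : IsFlatBrownian W P)
    {U : ℝ≥0 → Ω → GaugeConfig 3 L (Matrix.specialUnitaryGroup (Fin 2) ℂ)}
    (hU0 : ∀ ω, U 0 ω = fun _ => 1)
    (hU : (latticeLangevinDynamics (fundamentalLatticeRep 2) β').IsSolution (fundamentalRep (Fin 2))
      hW.natFiltration P W U)
    {f : GaugeConfig 3 L (Matrix.specialUnitaryGroup (Fin 2) ℂ) → ℝ} (hf : Measurable f) (t : ℝ≥0) :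
    ∫ ω, f (fun e : Edge 3 L => U t ω (e.1 + a, e.2)) ∂P = ∫ ω, f (U t ω) ∂P := by
  have hmU : Measurable (U t) := (hU.adapted t).mono (hW.natFiltration.le t) le_rfl
  have hlaw := map_translate_coldStart β' a hW hU0 hU t
  calc ∫ ω, f (fun e : Edge 3 L => U t ω (e.1 + a, e.2)) ∂P
      = ∫ v, (f ∘ fun y : GaugeConfig 3 L (Matrix.specialUnitaryGroup (Fin 2) ℂ) => fun e : Edge 3 L => y (e.1 + a, e.2)) v
          ∂(Measure.map (U t) P) :=
        (integral_map hmU.aemeasurable (hf.comp (measurable_compTranslate a)).aestronglyMeasurable).symm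
    _ = ∫ v, f v ∂((Measure.map (U t) P).map (fun y : GaugeConfig 3 L (Matrix.specialUnitaryGroup (Fin 2) ℂ) =>
          fun e : Edge 3 L => y (e.1 + a, e.2))) :=
        (integral_map (measurable_compTranslate a).aemeasurable hf.aestronglyMeasurable).symm
    _ = ∫ v, f v ∂(Measure.map (U t) P) := by rw [hlaw]
    _ = ∫ ω, f (U t ω) ∂P := integral_map hmU.aemeasurable hf.aestronglyMeasurable

end Law


end Summit.QuantumFields.YangMills.Theorems.ColdStartUniversality.TranslationCovariance

end
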